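import Mathlib
import HarnessLib
import Literature.NumberTheory.LFunctions.TuranKubilius

/-!
# Sums of non-negative submultiplicative functions (Elliott 1985, Ch. 1, Lemma (1.1))

An arithmetic function `g ≥ 0` is *submultiplicative* if `g(ab) ≤ g(a) g(b)` for coprime `a, b`.
Elliott (*Arithmetic Functions and Integer Products*, Grundlehren 272, Springer 1985, Ch. 1,
Lemma (1.1), p. 21): for `x ≥ 2`,
`∑_{n ≤ x} g(n) ≤ (x/log x + 10x/(log x)²) Δ ∑_{n ≤ x} g(n)/n`,
`Δ = sup_{1 ≤ y ≤ x} y⁻¹ ∑_{p^α ≤ y} g(p^α) log p^α` — "the general design of lemma (1.1) is to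
estimate `g(n)` in terms of its values on the prime-powers" (p. 23). It is the workhorse behind
Elliott's generalized Turán–Kubilius inequalities (Lemmas (1.3)–(1.4)) and the mean-value
estimates of Chapters 3 and 9.

## What is here (fully proved)

* `sum_mul_log_le_of_submultiplicative` — the CORE inequality of the printed proof (p. 22):
  `S(x) = ∑_{m ≤ x} g(m) log m ≤ x Δ ∑_{t ≤ x} g(t)/t`, for natural `x = N`, with `Δ` rendered
  hypothesis-style (`∑_{q ≤ y} g(q) log q ≤ Δ y` for all `y ≤ N`, `q` over prime powers).
  Proof as printed: `log m = ∑_{p^α ∥ m} log p^α`, `g(p^α t) ≤ g(p^α) g(t)` for `(t, p) = 1`,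
  interchange of summations (exact prime-power divisors from `TuranKubilius.lean`).
* `sum_le_of_submultiplicative` — a consequence with CRUDER constants than the printed ones:
  `∑_{m ≤ N} g(m) ≤ (2NΔ/log N + √N) ∑_{t ≤ N} g(t)/t` for `N ≥ 2` (split at `√N` instead of the
  printed integration by parts `∫₂^x dS(w)/log w`, which gives `x/log x + 10x/(log x)²`).

## Not here

The printed constants (partial integration); the second assertion of Lemma (1.1)
(`(log x)⁻¹ ∑_{n<x} g(n)/n ≤ c₀ exp(∑_{p^α<x} (g(p^α) − 1) p^{-α})`, via Lemma (1.2)/Mertens);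
real `x` (take `N = ⌊x⌋`).

## Source

* P. D. T. A. Elliott, *Arithmetic Functions and Integer Products*, Springer 1985, Ch. 1,
  Lemma (1.1), pp. 21–23. [Elliott1985]
-/

open Finset

namespace Literature.NumberTheory.LFunctions.SubmultiplicativeSums

open Literature.NumberTheory.LFunctions.Elliott1985 (IsAdditiveArith)
open Literature.NumberTheory.LFunctions.TuranKubilius (eq_sum_filter_exact primePow_spec)

/-! ### Sums of submultiplicative functions (Elliott 1985, Ch. 1, Lemma (1.1), core inequality) -/

/-- `log` is additive: `log n = ∑_{p ∣ n} log p^{v_p(n)}` in the form needed here,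
`log n = ∑_{q ≤ N, q ∥ n} log q` for `1 ≤ n ≤ N`. [folklore] -/
theorem log_eq_sum_filter_exact {N n : ℕ} (hn : n ≠ 0) (hnN : n ≤ N) :
    Real.log n = ∑ q ∈ ((Finset.Ioc 0 N).filter IsPrimePow).filter
        (fun q => n.factorization q.minFac = q.factorization q.minFac), Real.log q := by
  have hlog : IsAdditiveArith (fun n : ℕ => Real.log n) := by
    intro r s hr hs _
    push_cast
    exact Real.log_mul (by positivity) (by positivity)
  exact eq_sum_filter_exact hlog hn hnN

/-- **Elliott 1985, Lemma (1.1), the core inequality** (p. 22: "`S(x) = ∑_{m ≤ x} g(m) log m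
≤ x Δ ∑_{t ≤ x} g(t) t⁻¹`"). Let `g ≥ 0` be submultiplicative (`g(ab) ≤ g(a) g(b)` for coprime
`a, b`) and suppose `∑_{q ≤ y} g(q) log q ≤ Δ y` for all `y ≤ N` (`q` over prime powers; i.e.
`Δ ≥ sup_{y ≤ N} y⁻¹ ∑_{p^α ≤ y} g(p^α) log p^α`). Then
`∑_{m ≤ N} g(m) log m ≤ N Δ ∑_{t ≤ N} g(t)/t`.
Proof as printed: `log m = ∑_{p^α ∥ m} log p^α`, `g(p^α t) ≤ g(p^α) g(t)` for `(t, p) = 1`, and an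
interchange of summations. [cite: Elliott1985, Ch. 1, Lemma (1.1)] -/
theorem sum_mul_log_le_of_submultiplicative (g : ℕ → ℝ) (hg0 : ∀ n, 0 ≤ g n)
    (hsub : ∀ a b : ℕ, 0 < a → 0 < b → a.Coprime b → g (a * b) ≤ g a * g b) (N : ℕ) {Δ : ℝ}
    (hΔ : ∀ y : ℕ, y ≤ N →
      ∑ q ∈ (Finset.Ioc 0 y).filter IsPrimePow, g q * Real.log q ≤ Δ * y) :
    ∑ m ∈ Finset.Ioc 0 N, g m * Real.log m ≤ N * Δ * ∑ t ∈ Finset.Ioc 0 N, g t / t := by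
  classical
  rcases Nat.eq_zero_or_pos N with hN0 | hNpos
  · subst hN0; simp
  have hΔ0 : 0 ≤ Δ := by
    have := hΔ 1 hNpos
    have he : (Finset.Ioc 0 1).filter IsPrimePow = ∅ := by decide
    rw [he, Finset.sum_empty] at this
    simpa using this
  set PP : ℕ → Finset ℕ := fun y => (Finset.Ioc 0 y).filter IsPrimePow with hPP
  set X : ℕ → ℕ → Prop := fun q n => n.factorization q.minFac = q.factorization q.minFac with hX
  have hPPmem : ∀ y q, q ∈ PP y ↔ (0 < q ∧ q ≤ y) ∧ IsPrimePow q := fun y q => by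
    simp [hPP, Finset.mem_filter, Finset.mem_Ioc]
  -- Step 1: `∑ g(m) log m = ∑_q log q ∑_{q ∥ m} g(m)`
  have hstep1 : ∑ m ∈ Finset.Ioc 0 N, g m * Real.log m
      = ∑ q ∈ PP N, Real.log q * ∑ m ∈ (Finset.Ioc 0 N).filter (fun m => X q m), g m := by
    calc ∑ m ∈ Finset.Ioc 0 N, g m * Real.log m
        = ∑ m ∈ Finset.Ioc 0 N, ∑ q ∈ PP N, (if X q m then g m * Real.log q else 0) := by
          refine Finset.sum_congr rfl fun m hm => ?_
          rw [Finset.mem_Ioc] at hm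
          rw [log_eq_sum_filter_exact (by omega) hm.2, Finset.mul_sum, Finset.sum_filter]
      _ = ∑ q ∈ PP N, ∑ m ∈ Finset.Ioc 0 N, (if X q m then g m * Real.log q else 0) :=
          Finset.sum_comm
      _ = ∑ q ∈ PP N, Real.log q * ∑ m ∈ (Finset.Ioc 0 N).filter (fun m => X q m), g m := by
          refine Finset.sum_congr rfl fun q _ => ?_
          rw [Finset.sum_filter, Finset.mul_sum]
          refine Finset.sum_congr rfl fun m _ => ?_
          split_ifs <;> ring
  -- Step 2: `∑_{m ≤ N, q ∥ m} g(m) ≤ g(q) ∑_{t ≤ N/q} g(t)`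
  have hstep2 : ∀ q ∈ PP N, ∑ m ∈ (Finset.Ioc 0 N).filter (fun m => X q m), g m
      ≤ g q * ∑ t ∈ Finset.Ioc 0 (N / q), g t := by
    intro q hq
    obtain ⟨⟨hq0, hqN⟩, hqpp⟩ := (hPPmem N q).mp hq
    obtain ⟨hp, hk, e⟩ := primePow_spec hqpp
    set F := (Finset.Ioc 0 N).filter (fun m => X q m) with hF
    -- structure of the `m` with `q ∥ m`
    have hFmem : ∀ m ∈ F, 0 < m ∧ m ≤ N ∧ q ∣ m ∧ Nat.Coprime q (m / q) := by
      intro m hm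
      simp only [hF, Finset.mem_filter, Finset.mem_Ioc, hX] at hm
      obtain ⟨⟨hm0, hmN⟩, hXm⟩ := hm
      have hqm : q ∣ m := by
        rw [← e, ← hXm]; exact Nat.ordProj_dvd m _
      refine ⟨hm0, hmN, hqm, ?_⟩
      -- `p ∤ m/q` since `v_p(m/q) = v_p(m) − v_p(q) = 0`
      have hcop : Nat.Coprime (q.minFac ^ q.factorization q.minFac) (m / q) := by
        refine Nat.Coprime.pow_left _ ((Nat.Prime.coprime_iff_not_dvd hp).mpr fun hpd => ?_)
        have hmq0 : m / q ≠ 0 := (Nat.div_pos (Nat.le_of_dvd hm0 hqm) hq0).ne'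
        have h1 : (m / q).factorization q.minFac
            = m.factorization q.minFac - q.factorization q.minFac := by
          rw [Nat.factorization_div hqm]; rfl
        have h2 : 0 < (m / q).factorization q.minFac := hp.factorization_pos_of_dvd hmq0 hpd
        omega
      rwa [e] at hcop
    calc ∑ m ∈ F, g m ≤ ∑ m ∈ F, g q * g (m / q) := by
          refine Finset.sum_le_sum fun m hm => ?_
          obtain ⟨hm0, -, hqm, hcop⟩ := hFmem m hm
          have hmq : 0 < m / q := Nat.div_pos (Nat.le_of_dvd hm0 hqm) hq0
          calc g m = g (q * (m / q)) := by rw [Nat.mul_div_cancel' hqm]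
            _ ≤ g q * g (m / q) := hsub q (m / q) hq0 hmq hcop
      _ = g q * ∑ m ∈ F, g (m / q) := by rw [Finset.mul_sum]
      _ = g q * ∑ t ∈ F.image (fun m => m / q), g t := by
          rw [Finset.sum_image]
          intro m hm m' hm' h
          simp only at h
          obtain ⟨-, -, hqm, -⟩ := hFmem m hm
          obtain ⟨-, -, hqm', -⟩ := hFmem m' hm'
          rw [← Nat.mul_div_cancel' hqm, ← Nat.mul_div_cancel' hqm', h]
      _ ≤ g q * ∑ t ∈ Finset.Ioc 0 (N / q), g t := by
          apply mul_le_mul_of_nonneg_left _ (hg0 q)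
          refine Finset.sum_le_sum_of_subset_of_nonneg ?_ fun t _ _ => hg0 t
          intro t ht
          rw [Finset.mem_image] at ht
          obtain ⟨m, hm, rfl⟩ := ht
          obtain ⟨hm0, hmN, hqm, -⟩ := hFmem m hm
          exact Finset.mem_Ioc.mpr ⟨Nat.div_pos (Nat.le_of_dvd hm0 hqm) hq0,
            Nat.div_le_div_right hmN⟩
  -- Step 3: interchange `∑_q g(q) log q ∑_{t ≤ N/q} g(t) = ∑_t g(t) ∑_{q ≤ N/t} g(q) log q`
  have hstep3 : ∑ q ∈ PP N, Real.log q * (g q * ∑ t ∈ Finset.Ioc 0 (N / q), g t)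
      = ∑ t ∈ Finset.Ioc 0 N, g t * ∑ q ∈ PP (N / t), g q * Real.log q := by
    calc ∑ q ∈ PP N, Real.log q * (g q * ∑ t ∈ Finset.Ioc 0 (N / q), g t)
        = ∑ q ∈ PP N, ∑ t ∈ Finset.Ioc 0 N,
            (if q * t ≤ N then Real.log q * g q * g t else 0) := by
          refine Finset.sum_congr rfl fun q hq => ?_
          obtain ⟨⟨hq0, hqN⟩, -⟩ := (hPPmem N q).mp hq
          rw [← Finset.sum_filter]
          have hset : (Finset.Ioc 0 N).filter (fun t => q * t ≤ N) = Finset.Ioc 0 (N / q) := by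
            ext t
            simp only [Finset.mem_filter, Finset.mem_Ioc, Nat.le_div_iff_mul_le hq0]
            constructor
            · rintro ⟨⟨ht0, -⟩, h⟩; exact ⟨ht0, by rwa [mul_comm] at h⟩
            · rintro ⟨ht0, h⟩
              refine ⟨⟨ht0, ?_⟩, by rwa [mul_comm]⟩
              exact le_trans (Nat.le_mul_of_pos_left t hq0) (by rwa [mul_comm] at h)
          rw [hset, Finset.mul_sum, Finset.mul_sum]
          refine Finset.sum_congr rfl fun t _ => ?_
          ring
      _ = ∑ t ∈ Finset.Ioc 0 N, ∑ q ∈ PP N,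
            (if q * t ≤ N then Real.log q * g q * g t else 0) := Finset.sum_comm
      _ = ∑ t ∈ Finset.Ioc 0 N, g t * ∑ q ∈ PP (N / t), g q * Real.log q := by
          refine Finset.sum_congr rfl fun t ht => ?_
          have ht0 : 0 < t := (Finset.mem_Ioc.mp ht).1
          rw [← Finset.sum_filter]
          have hset : (PP N).filter (fun q => q * t ≤ N) = PP (N / t) := by
            ext q
            simp only [Finset.mem_filter, hPPmem, Nat.le_div_iff_mul_le ht0]
            constructor
            · rintro ⟨⟨⟨hq0, -⟩, hq⟩, h⟩; exact ⟨⟨hq0, h⟩, hq⟩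
            · rintro ⟨⟨hq0, h⟩, hq⟩
              exact ⟨⟨⟨hq0, le_trans (Nat.le_mul_of_pos_right q ht0) h⟩, hq⟩, h⟩
          rw [hset, Finset.mul_sum]
          refine Finset.sum_congr rfl fun q _ => ?_
          ring
  -- assemble
  calc ∑ m ∈ Finset.Ioc 0 N, g m * Real.log m
      = ∑ q ∈ PP N, Real.log q * ∑ m ∈ (Finset.Ioc 0 N).filter (fun m => X q m), g m := hstep1
    _ ≤ ∑ q ∈ PP N, Real.log q * (g q * ∑ t ∈ Finset.Ioc 0 (N / q), g t) := by
        refine Finset.sum_le_sum fun q hq => ?_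
        obtain ⟨⟨hq0, -⟩, -⟩ := (hPPmem N q).mp hq
        have hlog : 0 ≤ Real.log q := Real.log_nonneg (by exact_mod_cast hq0)
        exact mul_le_mul_of_nonneg_left (hstep2 q hq) hlog
    _ = ∑ t ∈ Finset.Ioc 0 N, g t * ∑ q ∈ PP (N / t), g q * Real.log q := hstep3
    _ ≤ ∑ t ∈ Finset.Ioc 0 N, g t * (Δ * (N / t : ℕ)) := by
        refine Finset.sum_le_sum fun t ht => ?_
        exact mul_le_mul_of_nonneg_left (hΔ (N / t) (Nat.div_le_self N t)) (hg0 t)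
    _ ≤ ∑ t ∈ Finset.Ioc 0 N, g t * (Δ * ((N : ℝ) / t)) := by
        refine Finset.sum_le_sum fun t ht => ?_
        exact mul_le_mul_of_nonneg_left (mul_le_mul_of_nonneg_left Nat.cast_div_le hΔ0) (hg0 t)
    _ = N * Δ * ∑ t ∈ Finset.Ioc 0 N, g t / t := by
        rw [Finset.mul_sum]
        refine Finset.sum_congr rfl fun t _ => ?_
        ring

/-- **Sums of submultiplicative functions** (a consequence of the core inequality of Elliott's
Lemma (1.1), with cruder constants than the printed `x/log x + 10x/(log x)²`): under the
hypotheses of `sum_mul_log_le_of_submultiplicative`, for `N ≥ 2`,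
`∑_{m ≤ N} g(m) ≤ (2NΔ/log N + √N) ∑_{t ≤ N} g(t)/t`
(split at `√N`: `g(m) ≤ 2 g(m) log m / log N` for `m > √N`, `g(m) ≤ √N g(m)/m` for `m ≤ √N`).
[cite: Elliott1985, Ch. 1, Lemma (1.1)] -/
theorem sum_le_of_submultiplicative (g : ℕ → ℝ) (hg0 : ∀ n, 0 ≤ g n)
    (hsub : ∀ a b : ℕ, 0 < a → 0 < b → a.Coprime b → g (a * b) ≤ g a * g b) {N : ℕ}
    (hN : 2 ≤ N) {Δ : ℝ}
    (hΔ : ∀ y : ℕ, y ≤ N →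
      ∑ q ∈ (Finset.Ioc 0 y).filter IsPrimePow, g q * Real.log q ≤ Δ * y) :
    ∑ m ∈ Finset.Ioc 0 N, g m
      ≤ (2 * N * Δ / Real.log N + Real.sqrt N) * ∑ t ∈ Finset.Ioc 0 N, g t / t := by
  have hcore := sum_mul_log_le_of_submultiplicative g hg0 hsub N hΔ
  have hN1 : (1 : ℝ) < N := by exact_mod_cast hN
  have hlogN : 0 < Real.log N := Real.log_pos hN1
  set z := Real.sqrt N with hz
  have hz0 : 0 ≤ z := Real.sqrt_nonneg _
  have hzz : z * z = N := Real.mul_self_sqrt (by positivity)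
  have hG0 : 0 ≤ ∑ t ∈ Finset.Ioc 0 N, g t / t := Finset.sum_nonneg fun t _ => by
    have := hg0 t; positivity
  have hS0 : 0 ≤ ∑ m ∈ Finset.Ioc 0 N, g m * Real.log m := Finset.sum_nonneg fun m hm => by
    have hm1 : (1 : ℝ) ≤ m := by exact_mod_cast (Finset.mem_Ioc.mp hm).1
    exact mul_nonneg (hg0 m) (Real.log_nonneg hm1)
  -- pointwise: `g m ≤ z g(m)/m + (2/log N) g(m) log m`
  have hpt : ∀ m ∈ Finset.Ioc 0 N,
      g m ≤ z * (g m / m) + 2 / Real.log N * (g m * Real.log m) := by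
    intro m hm
    have hm0 : (0 : ℝ) < m := by exact_mod_cast (Finset.mem_Ioc.mp hm).1
    have hm1 : (1 : ℝ) ≤ m := by exact_mod_cast (Finset.mem_Ioc.mp hm).1
    have hlogm : 0 ≤ Real.log m := Real.log_nonneg hm1
    have hA : 0 ≤ z * (g m / m) := mul_nonneg hz0 (div_nonneg (hg0 m) hm0.le)
    have hB : 0 ≤ 2 / Real.log N * (g m * Real.log m) := by
      have := hg0 m; positivity
    rcases le_or_gt (m : ℝ) z with hmz | hzm
    · -- small `m`: `g m = m (g m / m) ≤ z (g m / m)`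
      calc g m = m * (g m / m) := by field_simp
        _ ≤ z * (g m / m) := mul_le_mul_of_nonneg_right hmz (div_nonneg (hg0 m) hm0.le)
        _ ≤ _ := le_add_of_nonneg_right hB
    · -- large `m`: `log m > (1/2) log N`
      have hlm : Real.log N ≤ 2 * Real.log m := by
        have h1 : Real.log (z * z) ≤ Real.log ((m : ℝ) * m) :=
          Real.log_le_log (by rw [hzz]; positivity) (by nlinarith)
        rw [hzz, Real.log_mul hm0.ne' hm0.ne'] at h1
        linarith
      calc g m = 2 / Real.log N * (g m * (Real.log N / 2)) := by field_simp
        _ ≤ 2 / Real.log N * (g m * Real.log m) := by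
            apply mul_le_mul_of_nonneg_left _ (by positivity)
            exact mul_le_mul_of_nonneg_left (by linarith) (hg0 m)
        _ ≤ _ := le_add_of_nonneg_left hA
  calc ∑ m ∈ Finset.Ioc 0 N, g m
      ≤ ∑ m ∈ Finset.Ioc 0 N, (z * (g m / m) + 2 / Real.log N * (g m * Real.log m)) :=
        Finset.sum_le_sum hpt
    _ = z * ∑ t ∈ Finset.Ioc 0 N, g t / t
        + 2 / Real.log N * ∑ m ∈ Finset.Ioc 0 N, g m * Real.log m := by
        rw [Finset.sum_add_distrib, Finset.mul_sum, Finset.mul_sum]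
    _ ≤ z * ∑ t ∈ Finset.Ioc 0 N, g t / t
        + 2 / Real.log N * (N * Δ * ∑ t ∈ Finset.Ioc 0 N, g t / t) := by
        have := mul_le_mul_of_nonneg_left hcore (show (0:ℝ) ≤ 2 / Real.log N by positivity)
        linarith
    _ = (2 * N * Δ / Real.log N + Real.sqrt N) * ∑ t ∈ Finset.Ioc 0 N, g t / t := by
        rw [hz]; ring

end Literature.NumberTheory.LFunctions.SubmultiplicativeSums
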